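import Summits.BirchSwinnertonDyer.BirchSwinnertonDyer.Theorems.ByReductionTypeAtTwoRankOneAtTwoBigImageOddLocalOneDoorBottomCebotarevCopy
import Summits.BirchSwinnertonDyer.BirchSwinnertonDyer.Theorems.ByReductionTypeAtTwoRankOneAtTwoBigImageOddLocalOneDoorBottomLeavesLines
import HarnessLib

/-!
# Route ByReductionTypeAtTwo, crux `RankOneAtTwoBigImageOddLocal` (stmt-BirchSwinnertonDyer-23715), LINE v8.9 `one_door_analytic`:
# ASSEMBLY — `FirstDescentInput W W^{(d_K)}` from the Heegner class and Kolyvagin's first-layer classes ALONE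

Width prover seat `bsd-line-fkl-p2` g10 (2026-08-28), `--supports stmt-BirchSwinnertonDyer-23715` (helper).  THEOREMS ONLY.  BSD is not proved by
any of this.

`nonempty_firstDescentInput_twist`: on route GenusKolyvaginAtTwo's LINE-6 habitat (`W` globally minimal, `Δ_W < 0`, no CM, surjective
`2`-adic tower, `K = ℚ(θ)` imaginary quadratic with `θ² = d_K` odd, `d_K·(−|Δ_W|)` not a square, `N_W ∣ N`) with a transposition prime
`q₀ ∣ d_K` of the door (`q₀` odd, good, `q₀ ∤ Δ_W`, `(Δ_W/q₀) = −1`, `v₀ ∋ q₀`), the lead's record `FirstDescentInput W (W.quadraticTwist d_K)`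
(p641630) is inhabited as soon as ONE supplies, for the canonical choice `q₀ := Sum.inl v₀`, `Kol := VisiblePairAtTwo.kolPrime W K 1`,
`pl := VisiblePairAtTwo.pl`:
* the Heegner class `y ∈ Sel₂(W)`, `y ≠ 0` (fields `y`, `y_mem`, `y_ne`), and
* Kolyvagin's first-layer classes `c₁ ℓ ∈ H¹(ℚ, W[2])`, `c₂ ℓ ∈ H¹(ℚ, W^{(d_K)}[2])` with Gross's Prop. 6.2 at `2` (fields `c₁_loc`,
  `c₁_loc_iff`, `c₂_loc`, `c₂_loc_iff`) — item 24880's first-layer face at `M = 2`.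
EVERY other field is a theorem of this seat's files: `rec₁_field`, `rec₂_field_twist` (below: any model of the twist, from
`rec_inl_of_card` and the twist count), `ceb₁_field`, `ceb₂_field`, `ceb₂'_field` (twin copy included), `line₁_inl`, `line₂_inl`.

The twin is taken to be the twist EQUATION `W.quadraticTwist d_K` (the record asks no minimality of `Wd`); the frame's Selmer
CARDINALITIES transport to the minimal model by the tree's `TwistFamilySelmerGroupCardInvariance`.

References: [GrossLMS1991] §§3–6, 8–10; [McCallumLMS1991] §§3–5; [MazurRubin2010] Lemma 2.2; [WZhang2014] Notations (xii).
-/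

set_option autoImplicit false
-- the Theorems namespace of this sub repeats the summit name by design (D-0017 nested layout)
set_option linter.dupNamespace false

noncomputable section

open scoped Classical

namespace Summit.BirchSwinnertonDyer.BirchSwinnertonDyer.Theorems.RankOneAtTwoOneDoor

open WeierstrassCurve NumberField IsDedekindDomain Field Rat.HeightOneSpectrum
open Literature.NumberTheory.EllipticCurves Literature.NumberTheory.GaloisRepresentations
open Summit.BirchSwinnertonDyer.BirchSwinnertonDyer.Theorems.GenusExact
open Summit.BirchSwinnertonDyer.BirchSwinnertonDyer.Theorems.GenusExact.VisiblePairAtTwo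

section Rat

variable (N : ℕ) [NeZero N] (W : WeierstrassCurve ℚ) [W.IsElliptic] [W.IsGloballyMinimal]
  {K : Type} [Field K] [NumberField K]

/-- **Field `rec₂` for ANY model `Wd = C • W^{(d_K)}` of the twin** (`W` globally minimal, `Δ_W < 0`; error place `v₀ ∋ q₀ ∣ d_K`): the
count `#Wd(ℚ_ℓ)[2] = #W(ℚ_ℓ)[2] = 2` at a `kolPrime W K 1` prime (`natCard_ker_nsmul_two_twist_adicCompletion_eq`,
`ReductionCyclic.natCard_ker_zsmul_adicCompletion_two_pow_eq` at `M = 1`) fed to `rec_inl_of_card`.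
[cite: GrossLMS1991, §10, Prop. 8.2] [cite: McCallumLMS1991, §5 Lemma 5.3] [cite: MazurRubin2010, Lemma 2.2 (i)] -/
theorem rec₂_field_twist (hΔ : W.Δ < 0) (Wd : WeierstrassCurve ℚ) [Wd.IsElliptic] {C : VariableChange ℚ}
    (hWd : C • W.quadraticTwist ((NumberField.discr K : ℤ) : ℚ) = Wd)
    {q₀ : ℕ} (hq₀ : q₀.Prime) (hq₀d : (q₀ : ℤ) ∣ NumberField.discr K) {v₀ : HeightOneSpectrum (𝓞 ℚ)} (hq₀v : (q₀ : 𝓞 ℚ) ∈ v₀.asIdeal) :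
    ∀ ℓ, kolPrime W K 1 ℓ → ∀ d : galH1Torsion Wd 2, (∀ v : RatPlace, v ≠ pl ℓ → v ≠ Sum.inl v₀ → d ∈ locAt Wd 2 v) → d ∉ locAt Wd 2 (pl ℓ) →
      ∀ s : galH1Torsion Wd 2, (∀ v : RatPlace, v ≠ Sum.inl v₀ → s ∈ locAt Wd 2 v) → s ∉ strictAt Wd 2 (pl ℓ) →
        s ∉ strictAt Wd 2 (Sum.inl v₀) := by
  intro ℓ hKol
  obtain ⟨hℓ, hℓ2, hℓd, hgood, -, hFrob, hidx, -⟩ := hKol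
  haveI : Fact ℓ.Prime := ⟨hℓ⟩
  have hd0 : ((NumberField.discr K : ℤ) : ℚ) ≠ 0 := by exact_mod_cast NumberField.discr_ne_zero K
  rw [pl_of_prime hℓ]
  refine rec_inl_of_card Wd hℓ2 (natCast_mem_primesEquiv_symm hℓ) ?_ v₀ (ne_primesEquiv_symm_of_dvd_discr hq₀ hq₀d hq₀v hℓ hℓd)
  rw [natCard_ker_nsmul_two_twist_adicCompletion_eq W hd0 hWd]
  have h := ReductionCyclic.natCard_ker_zsmul_adicCompletion_two_pow_eq W hΔ hℓ2 hgood hFrob (natCast_mem_primesEquiv_symm hℓ) (M := 1) hidx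
  rw [← zsmulAddGroupHom_natCast]
  simpa using h

/-- **ASSEMBLY: `FirstDescentInput W W^{(d_K)}` from the Heegner class and Kolyvagin's first-layer classes alone.**  On the `Δ_W < 0`
habitat with a transposition prime `q₀ ∣ d_K` (hypotheses as in the module docstring), given the Heegner class `y ∈ Sel₂(W)`, `y ≠ 0`, and
first-layer classes `c₁`, `c₂` with Gross's Prop. 6.2 at `2` for `Kol := kolPrime W K 1`, `pl := pl`, `q₀ := Sum.inl v₀`, the record is
inhabited — `rec₁`/`rec₂`/`ceb₁`/`ceb₂`/`ceb₂'`/`line₁`/`line₂` are THEOREMS (`rec₁_field`, `rec₂_field_twist`, `ceb₁_field`, `ceb₂_field`,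
`ceb₂'_field`, `line₁_inl`, `line₂_inl`). [cite: GrossLMS1991, §§3–6, 8–10] [cite: McCallumLMS1991, §§3–5] [cite: MazurRubin2010, Lemma 2.2 (i)] -/
theorem nonempty_firstDescentInput_twist (hN : W.conductorNorm ℤ ∣ N) (hcm : ¬ W.HasCM) (hΔ : W.Δ < 0) (hK : IsImaginaryQuadratic K)
    (hodd : Odd (NumberField.discr K)) (hns : ¬ IsSquare ((NumberField.discr K : ℚ) * -|W.Δ|))
    (hρ : ∀ n : ℕ, W.HasSurjectiveModNGaloisRep (2 ^ n : ℕ))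
    {θ : K} (hθ : θ ∉ Set.range (algebraMap ℚ K)) (hc : θ ^ 2 = algebraMap ℚ K ((NumberField.discr K : ℤ) : ℚ))
    [(W.quadraticTwist ((NumberField.discr K : ℤ) : ℚ)).IsElliptic]
    {q₀ : ℕ} [hq₀ : Fact q₀.Prime] (hq₀2 : q₀ ≠ 2) (hq₀d : (q₀ : ℤ) ∣ NumberField.discr K) (hgood₀ : W.HasGoodReductionAtPrime q₀)
    (hqΔ : ¬ (q₀ : ℤ) ∣ W.Δ.num) (hjac : jacobiSym W.Δ.num q₀ = -1)
    {v₀ : HeightOneSpectrum (𝓞 ℚ)} (hq₀v : (q₀ : 𝓞 ℚ) ∈ v₀.asIdeal)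
    (y : galH1Torsion W 2) (hy_mem : y ∈ selmerGroup W 2) (hy_ne : y ≠ 0)
    (c₁ : ℕ → galH1Torsion W 2) (c₂ : ℕ → galH1Torsion (W.quadraticTwist ((NumberField.discr K : ℤ) : ℚ)) 2)
    (hc₁_loc : ∀ ℓ, kolPrime W K 1 ℓ → ∀ v : RatPlace, v ≠ pl ℓ → v ≠ Sum.inl v₀ → c₁ ℓ ∈ locAt W 2 v)
    (hc₁_loc_iff : ∀ ℓ, kolPrime W K 1 ℓ → (c₁ ℓ ∈ locAt W 2 (pl ℓ) ↔ y ∈ strictAt W 2 (pl ℓ)))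
    (hc₂_loc : ∀ ℓ, kolPrime W K 1 ℓ → ∀ v : RatPlace, v ≠ pl ℓ → v ≠ Sum.inl v₀ →
      c₂ ℓ ∈ locAt (W.quadraticTwist ((NumberField.discr K : ℤ) : ℚ)) 2 v)
    (hc₂_loc_iff : ∀ ℓ, kolPrime W K 1 ℓ →
      (c₂ ℓ ∈ locAt (W.quadraticTwist ((NumberField.discr K : ℤ) : ℚ)) 2 (pl ℓ) ↔ y ∈ strictAt W 2 (pl ℓ))) :
    Nonempty (FirstDescentInput W (W.quadraticTwist ((NumberField.discr K : ℤ) : ℚ))) := by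
  have hd0 : ((NumberField.discr K : ℤ) : ℚ) ≠ 0 := by exact_mod_cast NumberField.discr_ne_zero K
  exact ⟨{
    q₀ := Sum.inl v₀
    Kol := kolPrime W K 1
    pl := pl
    y := y
    y_mem := hy_mem
    y_ne := hy_ne
    c₁ := c₁
    c₂ := c₂
    c₁_loc := hc₁_loc
    c₁_loc_iff := hc₁_loc_iff
    c₂_loc := hc₂_loc
    c₂_loc_iff := hc₂_loc_iff
    rec₁ := rec₁_field W hΔ hq₀.out hq₀d hq₀v
    rec₂ := rec₂_field_twist W hΔ (W.quadraticTwist ((NumberField.discr K : ℤ) : ℚ)) (C := 1) (one_smul _ _) hq₀.out hq₀d hq₀v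
    ceb₁ := ceb₁_field N W hN hcm hΔ hK hodd hns hρ hθ hc hy_ne
    ceb₂ := ceb₂_field N W hN hcm hΔ hK hodd hns hρ hθ hc y hy_ne (Sum.inl v₀)
    ceb₂' := ceb₂'_field N W hN hcm hΔ hK hodd hns hρ hθ hc y hy_ne (Sum.inl v₀)
    line₁ := line₁_inl W hq₀2 hgood₀ hqΔ hjac hq₀v
    line₂ := line₂_inl W hq₀2 hgood₀ hqΔ hjac hq₀v hd0 (W.quadraticTwist ((NumberField.discr K : ℤ) : ℚ)) (C := 1) (one_smul _ _) }⟩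

end Rat

end Summit.BirchSwinnertonDyer.BirchSwinnertonDyer.Theorems.RankOneAtTwoOneDoor

end
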